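import Summits.BirchSwinnertonDyer.Rank1Residual.X11b.Three.CornerResidual
import HarnessLib

/-!
# Route `ClassRecordThree` (rung K2@3), crux 7 `CornerAtThree` (item stmt-BirchSwinnertonDyer-19111, shared with
# `KolyvaginRoadThree`): the OBJECT the co-chain road posits — the Kolyvagin-system («⊇») half of the anticyclotomic
# BDP main conjecture at the trivial character, as Theses-free `Prop`-valued predicates (cell `bsd-stepL`,
# width-lever second lane `bsd-stepL-corner3-p2`; `--supports stmt-BirchSwinnertonDyer-19111`; definitions home)

This module imports NO Theses file, so both route files wanting 19111 may import it and type the object BY NAME.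
Three `Prop`-valued PREDICATES (typed SHAPES, tagged `@[conjecture]` where closed: each is implied by BSD, nothing
is asserted), two bookkeeping lemmas; NO named fact; no `sorry`. They are the exact TWINS of three tree predicates,
obtained by reversing ONE inequality:

| tree (the «⊆» half: Eisenstein ∕ STEP-L side)            | this file (the «⊇» half: Kolyvagin-system ∕ upper side)   |
|-----------------------------------------------------------|------------------------------------------------------------|
| `X11b.IMCLowerWaldspurgerOnTreeAt p κ 𝔭 γ ι P`            | `X11b.IMCUpperWaldspurgerOnTreeAt p κ 𝔭 γ ι P`             |
|   `∃ n, HasCharValuationAt X_ac n ∧ 2(ord_p log_ω P − 1) ≤ n` |   `∃ n, HasCharValuationAt X_ac n ∧ n ≤ 2(ord_p log_ω P − 1)` |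
| `X11b.Three.CornerStepLAt W` (x11b3-p8, `CornerResidual`) | `X11b.Three.CornerCoStepLAt W`                             |
| `Theorems.CornerAtThreeStepL` (corner-p1 g6, p488767)     | `Theorems.CornerAtThreeCoStepL`                            |

WHY (the co-chain road, this lane's files p527420 ∕ p528380 ∕ …Tight): conjunct 3 of the crux, `Three.CornerUpperAt W`
(the Tamagawa-SHARP Kolyvagin bound `ord₃ #Ш(E/K) + 2·ord₃ ∏_ℓ c_ℓ(E) ≤ 2·ord₃ [E(K):ℤP]` on the ¬Surj corner at `3`), is
EQUIVALENT — modulo cited facts only, the anticyclotomic control identity being a theorem at every multiplicative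
rank-one datum (`X11b.controlOnTreeAt_of_mult_of_rankOne_odd`) — to the «⊇» half at `𝟙` on the corner frames
(`Three.cornerCoIMC_iff_cornerUpperAt_of_facts`). Those files state the half INLINE; this file gives it its NAME, so
that the planner can re-cut `stub_cornerUpper3` as ONE typed stub and so that `CornerStepLAt ∧ CornerCoStepLAt` reads
as the two inclusions of ONE main conjecture at `𝟙` (`imcWaldspurgerOnTreeAt_iff_lower_and_upper`).

STATUS IN PRINT of the «⊇» half (the Kolyvagin-SYSTEM bound): Howard 2004 Thm. B (`p ∤ 6N`, `ρ_{E,p}` onto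
`GL₂(ℤ_p)`); Burungale–Castella–Kim 2021 and Burungale–Castella–Skinner arXiv:2405.00270 Thm. 1.2.2 (good ordinary
`p > 3`, (irr_ℚ), in `Λ ⊗ ℚ_p`; integrally under (sur); «the only case excluded … is that of (residually) dihedral
primes … treated in [BS24]» = Burungale–Skinner, *Anticyclotomic Iwasawa theory of elliptic curves at dihedral
primes*, 2024, not available); Castella's erratum Thm. 2.3 lower half (Hida members of weight `k > 2`, erratum fields,
`p > 3`). On the (T4″)@3 corner — `p = 3 ∥ N`, image of `ρ̄_{E,3}` the normaliser of a Cartan (3Ns = `D₄` or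
3Nn = `SD₁₆`), classical Heegner field — NOTHING is in print: OPEN. Nothing is asserted here.

References: [Castella2018] Def. 2.2, Thm. 2.3, Thm. 3.2, §5 (5.1)–(5.2) (arXiv:1704.06608 pp. 5, 9, 12);
[Castella2018Erratum] Thm. 1.1, Thm. 2.3; [Howard2004] B. Howard, *The Heegner point Kolyvagin system*, Compos. Math.
140 (2004) 1439–1472, Thm. B; [BurungaleCastellaKim2021] Thm. A, §5; Burungale–Castella–Skinner arXiv:2405.00270
Thm. 1.2.2, Rem. 1.2.3; [JetchevSkinnerWan2017] §7.4.2; tree `X11b/AnticyclotomicLowerLinks.lean`,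
`X11b/Three/CornerResidual.lean`, `Theorems/ClassRecordThreeCornerAtThreeBranchesDefs.lean`.
-/

noncomputable section

open scoped Classical

open WeierstrassCurve NumberField IsDedekindDomain Field Literature.NumberTheory.EllipticCurves
  Literature.NumberTheory.EllipticCurves.ModularForms
  Literature.NumberTheory.EllipticCurves.Rank1Residual
  Literature.NumberTheory.EllipticCurves.Rank1Residual.Typed
  Literature.NumberTheory.QuadraticFields.Quadratic
  Summit.BirchSwinnertonDyer.Rank1Residual.X11b.AcSelmer

set_option autoImplicit false
set_option linter.dupNamespace false

namespace Summit.BirchSwinnertonDyer.Rank1Residual.X11b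

/-! ### §1. The «⊇» half at a datum, every symbol a tree object -/

section Links

variable {W : WeierstrassCurve ℚ} [W.IsElliptic] [W.IsGloballyMinimal] {K : Type} [Field K]
  [NumberField K]
variable (p : ℕ) [Fact p.Prime] (κ : ZpExtension K p) (𝔭 : HeightOneSpectrum (𝓞 K))
  (γ : Field.absoluteGaloisGroup K) [Fact (κ.IsTopGenerator γ)] (ι : K →+* ℚ_[p])

/-- **(IMC⊇) ∘ (BDP) at the trivial character, EVERY SYMBOL A TREE OBJECT — OPEN ∘ PUB** (the co-chain's input):
the Kolyvagin-SYSTEM half "`(L_p(f))Λ_{R₀} ⊆ Ch_Λ(X_ac(E[p^∞]))Λ_{R₀}`" of the anticyclotomic main conjecture for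
Castella's Selmer group (`f_ac ∣ L_p(f)·u`; Howard 2004 Thm. B ∕ Perrin-Riou's Heegner point main conjecture «⊇»,
transported to the BDP side as in Burungale–Castella–Kim 2021 §5) read at `𝟙`, `ord_p f_ac(0) ≤ ord_p L_p(f)(𝟙)`,
composed with Cas18 Thm. 3.2 at `p ∣ N` [`L_p(f)(𝟙) = (1 − a_p p⁻¹)²(log_{ω_E} P_K)²` up to a unit, PUB]:
`n ≤ 2·(ord_p log_ω P − 1)` for `n = ord_p f(0)`, `f` a generator (with `f(0) ≠ 0`) of the characteristic ideal of
the constructed `Λ`-torsion `X_ac = AcSelmer.XAc (E_K) p κ 𝔭 ∅ γ`, `ord_p log_ω P = padicLogOrd W p ι P`. The TWIN of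
`IMCLowerWaldspurgerOnTreeAt` (inequality reversed); together they are route R1's equality `IMCWaldspurgerOnTreeAt`
(`imcWaldspurgerOnTreeAt_iff_lower_and_upper`). A predicate; NEVER a theorem; nothing asserted.
[cite: Castella2018, Thm. 3.2 (arXiv:1704.06608 p. 9) and §5 (5.1) (p. 12) (shape only; nothing asserted)] -/
def IMCUpperWaldspurgerOnTreeAt (P : (W.baseChange K).toAffine.Point) : Prop :=
  ∃ n : ℕ, XAc.HasCharValuationAt (W.baseChange K) p κ 𝔭 ∅ γ n ∧
    (n : ℤ) ≤ 2 * (padicLogOrd W p ι P - 1)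

variable {p κ 𝔭 γ ι}

/-- Route R1's equality link ⟺ both one-sided links (the generator's valuation is unique,
`XAc.HasCharValuationAt.unique`). Bookkeeping. [folklore] -/
theorem imcWaldspurgerOnTreeAt_iff_lower_and_upper {P : (W.baseChange K).toAffine.Point} :
    IMCWaldspurgerOnTreeAt p κ 𝔭 γ ι P ↔
      IMCLowerWaldspurgerOnTreeAt p κ 𝔭 γ ι P ∧ IMCUpperWaldspurgerOnTreeAt p κ 𝔭 γ ι P := by
  refine ⟨fun ⟨n, hn, hne⟩ ↦ ⟨⟨n, hn, le_of_eq hne.symm⟩, ⟨n, hn, le_of_eq hne⟩⟩,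
    fun ⟨⟨n, hn, hle⟩, ⟨n', hn', hle'⟩⟩ ↦ ?_⟩
  obtain rfl : n = n' := hn.unique hn'
  exact ⟨n, hn, le_antisymm hle' hle⟩

/-- The equality link implies the «⊇» half. Bookkeeping. [folklore] -/
theorem imcUpperWaldspurgerOnTreeAt_of_imcWaldspurgerOnTreeAt {P : (W.baseChange K).toAffine.Point}
    (h : IMCWaldspurgerOnTreeAt p κ 𝔭 γ ι P) : IMCUpperWaldspurgerOnTreeAt p κ 𝔭 γ ι P :=
  (imcWaldspurgerOnTreeAt_iff_lower_and_upper.mp h).2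

end Links

/-! ### §2. Class level at `p = 3`: the «⊇» half on the corner frames -/

namespace Three

/-- OPEN (typed open input, no source, CONSTRUCTION-SHAPED; implied by BSD₃(E/K) through the control identity —
`Theorems/ClassRecordThreeCornerAtThreeUpperCoChainTight.lean`) — **`CornerCoStepLAt W`: the Kolyvagin-SYSTEM («⊇»)
half of the anticyclotomic BDP main conjecture at `𝟙` on the (T4″)@3 CORNER, i.e. `Three.CornerStepLAt W` VERBATIM
with its conclusion `IMCLowerWaldspurgerOnTreeAt` replaced by the twin `IMCUpperWaldspurgerOnTreeAt`.** For `W/ℚ`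
globally minimal with `(E,3) ∈` X11b and `ρ̄_{E,3}` NOT surjective (image 3Ns = `D₄` or 3Nn = `SD₁₆`): for every
imaginary quadratic `K` with `d_K` odd satisfying the Heegner hypothesis for `N = N_E` and `L(E^{d_K},1) ≠ 0`, every
modular parametrisation `Dt` of level `N_E` with `3 ∤ c`, every Heegner datum `H` with `P ∈ E(K)` THE Heegner point
of infinite order, every anticyclotomic `ℤ₃`-extension `κ` with generator `γ` and degree-one `𝔭 ∣ 3`:
`IMCUpperWaldspurgerOnTreeAt 3 κ 𝔭 γ embAt P` ("`(L_𝔭^{BDP}(f)) ⊆ Ch_Λ(X_ac)Λ^{ur}` read at `𝟙`":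
`ord₃ f_ac(0) ≤ 2·(ord₃ log_ω P − 1)`). With the control identity (a theorem at every corner frame modulo cited
facts, `Three.cornerControlOnTree_of_facts`) it GIVES and IS GIVEN BY the Tamagawa-sharp bound `Three.CornerUpperAt W`
on `3 ∣ ∏c` (this lane's co-chain files) — and on `3 ∤ ∏c` it follows from Matar–Nekovář 2019 Thm. 0.3. NO source
at `3` (nor at any `p` for a dihedral image: Howard 2004 ∕ BCK21 ∕ BCS24 need (sur) or exclude dihedral primes;
[BS24] unavailable). A predicate on `W`; NEVER a theorem in this cell; every result using it is CONDITIONAL.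
[cite: Castella2018, Thm. 3.2 (arXiv:1704.06608 p. 9) (shape only, read at p = 3 without Surj; nothing asserted)] -/
def CornerCoStepLAt (W : WeierstrassCurve ℚ) [W.IsElliptic] [W.IsGloballyMinimal] : Prop :=
  ∀ (N : ℕ) [NeZero N] (K : Type) [Field K] [NumberField K]
    (Dt : ModularParametrizationData W N) (H : HeegnerDatum N (NumberField.discr K)) (ι : K →+* ℂ)
    (P : (W.baseChange K).toAffine.Point),
    ClassX11b W 3 → ¬ Surj W 3 → W.conductorNorm ℤ = N → IsImaginaryQuadratic K →
    Odd (NumberField.discr K) → SatisfiesHeegnerHypothesis N K →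
    (W.quadraticTwist (NumberField.discr K : ℚ)).entireLFunction 1 ≠ 0 →
    WeierstrassCurve.Affine.Point.map ι.toRatAlgHom P = heegnerPointComplex Dt H →
    ¬ (3 : ℤ) ∣ Dt.c → ¬ IsOfFinAddOrder P →
    ∀ (κ : ZpExtension K 3), κ.IsAnticyclotomic →
      ∀ (γ : Field.absoluteGaloisGroup K) [Fact (κ.IsTopGenerator γ)]
        (𝔭 : HeightOneSpectrum (𝓞 K)) (h𝔭 : ((3 : ℕ) : 𝓞 K) ∈ 𝔭.asIdeal)
        (he : 𝔭.asIdeal.ramificationIdx (𝓞 ℚ) = 1) (hf : 𝔭.asIdeal.inertiaDeg (𝓞 ℚ) = 1),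
        IMCUpperWaldspurgerOnTreeAt 3 κ 𝔭 γ (embAt K 3 𝔭 h𝔭 he hf) P

end Three

end Summit.BirchSwinnertonDyer.Rank1Residual.X11b

namespace Summit.BirchSwinnertonDyer.BirchSwinnertonDyer.Theorems

open Summit.BirchSwinnertonDyer.Rank1Residual Summit.BirchSwinnertonDyer.Rank1Residual.X11b.Three

/-- [crux branch CoStepL of item 19111 `CornerAtThree`, co-chain road] **the «⊇» (Kolyvagin-system) half at `𝟙`
on the (T4″)@3 corner for EVERY curve**: `∀ W, Three.CornerCoStepLAt W` — the Theses-free constant the planner can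
register as the ONE open stub of `stub_cornerUpper3` along the co-chain (twin of `CornerAtThreeStepL`, p488767).
A `Prop` constant; OPEN; nothing asserted. [cite: Castella2018, Thm. 3.2 (arXiv:1704.06608 p. 9) (shape only; nothing asserted)] -/
@[conjecture]
def CornerAtThreeCoStepL : Prop :=
  ∀ (W : WeierstrassCurve ℚ) [W.IsElliptic] [W.IsGloballyMinimal], CornerCoStepLAt W

end Summit.BirchSwinnertonDyer.BirchSwinnertonDyer.Theorems

end
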